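import Literature.Computability.AlgebraicComplexity.BI17FormsGenericNonNormalityProofs
import Literature.Computability.AlgebraicComplexity.BI17InvariantsRectangularHighestWeight
import HarnessLib

/-!
# Bürgisser–Ikenmeyer 2017, Cor. 3.17 (2) for binary forms of degree `9`, `10` — PROVED:
# almost every such binary form has a non-normal `GL_2`-orbit closure

P. Bürgisser, C. Ikenmeyer, *Fundamental invariants of orbit closures*, J. Algebra **477** (2017)
390–434 = arXiv:1511.02927 [BurgisserIkenmeyer2017], Cor. 3.17 (2) (TeX L1170): "Suppose that
`a'(D,m) = 1` and let `w ∈ Sym^D ℂ^m` be generic. Then `\overline{Gw}` is not normal if `D` is odd, or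
if `D` is even and `gcd(D,m) > 1`." For binary forms every `D ≥ 5` qualifies (`a'(D,2) = 1` by App.
Prop. 7.4 (3), the tree's `BI2017_prop_A_4_part3`); the printed proof needs generic polystability
(Prop. 2.10, open in the tree beyond `(4,2)`). THEOREMS ONLY (cell `val-lit`, row BI2017-A;
companion of `BI17GenericBinaryQuinticSexticNonNormal.lean`, same method); no definition, no named
fact; the named facts of `BI17FundamentalInvariantForms.lean` are not restated.

## Method (ours): two invariant degrees, by kernel plethysm values

`isZariskiGeneric_not_isIntegrallyClosed_of_invariants` (this seat, `BI17FormsGenericNonNormalityProofs`: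
nonzero `SL_2`-invariants of degrees `(2/g)t`, `(2/g)(t+1)` ⇒ generic non-normality, no Prop. 2.10)
+ val-lit-p4's `mem_genericDegreeMonoid_iff_plethysmCoeff_ne_zero` + DIP (4.4) with `ℓ = 2`
(`DIP20_eq_4_4_holds`, `dipMonomialCount_eq_L`, `decide +kernel`; the values are the classical
Cayley–Sylvester numbers).

| `D` | `g` | degrees | kernel values | `a(D,2)` |
|---|---|---|---|---|
| `9` | `1` | `8, 10` (`t = 4`) | `a_{(36,36)}(8[9]) = 8`, `a_{(45,45)}(10[9]) = 5` | `9` |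
| `10` | `2` | `8, 9` (`t = 8`) | `a_{(40,40)}(8[10]) = 12`, `a_{(45,45)}(9[10]) = 5` | `5` |


Honest framing: classical invariant theory of binary forms as typed-literature bookkeeping (cell
`val-lit`, LADDER-VALIANT V3); nothing here bears on VP versus VNP.

## References

* [BurgisserIkenmeyer2017] Cor. 3.17 (L1170), App. Prop. 7.4 (L2943), Def. 3.6.
* [DorflerIkenmeyerPanova2020] eqs. (4.3)–(4.4) (arXiv p. 9).
-/

namespace Literature.Computability.AlgebraicComplexity

open MvPolynomial
open _root_.Literature.NumberTheory.DiophantineGeometry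

/-- A weakly decreasing pair is antitone. [folklore] -/
private theorem antitone_fin_two {a b : ℕ} (h : b ≤ a) : Antitone (![a, b] : Fin 2 → ℕ) := by
  intro i j hij
  fin_cases i <;> fin_cases j
  · exact le_rfl
  · simpa using h
  · simp at hij
  · exact le_rfl

/-! ### `D = 9` -/

section Degree9

set_option maxHeartbeats 2000000 in -- two kernel monomial counts (DIP (4.3))
/-- **`a_{(36,36)}(8[9]) = 8`** (binary nonics: invariants of degree `8`). (4.4) over `𝔖_2`, `decide +kernel`.
[cite: DorflerIkenmeyerPanova2020, eqs. (4.3)–(4.4)] -/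
theorem plethysmCoeff_nine_rowDual_thirtysix_thirtysix :
    plethysmCoeff ℂ (Fin 2) 9 (rowDual ![36, 36]) = 8 := by
  have h : (plethysmCoeff ℂ (Fin 2) 9 (rowDual ![36, 36]) : ℤ) = 8 := by
    rw [DIP20_eq_4_4_holds 2 9 8 ![36, 36] (by norm_num) (antitone_fin_two le_rfl)
      (by rw [Fin.sum_univ_two]; rfl)]
    simp only [dipMonomialCount_eq_L]
    decide +kernel
  exact_mod_cast h

set_option maxHeartbeats 2000000 in -- two kernel monomial counts (DIP (4.3))
/-- **`a_{(45,45)}(10[9]) = 5`** (binary nonics: invariants of degree `10`). (4.4) over `𝔖_2`, `decide +kernel`.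
[cite: DorflerIkenmeyerPanova2020, eqs. (4.3)–(4.4)] -/
theorem plethysmCoeff_nine_rowDual_fortyfive_fortyfive :
    plethysmCoeff ℂ (Fin 2) 9 (rowDual ![45, 45]) = 5 := by
  have h : (plethysmCoeff ℂ (Fin 2) 9 (rowDual ![45, 45]) : ℤ) = 5 := by
    rw [DIP20_eq_4_4_holds 2 9 10 ![45, 45] (by norm_num) (antitone_fin_two le_rfl)
      (by rw [Fin.sum_univ_two]; rfl)]
    simp only [dipMonomialCount_eq_L]
    decide +kernel
  exact_mod_cast h

/-- `8 ∈ E(9,2)`. [cite: BurgisserIkenmeyer2017, Def. 3.6] -/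
theorem eight_mem_genericDegreeMonoid_nine_two : 8 ∈ genericDegreeMonoid (Fin 2) ℂ 9 := by
  rw [mem_genericDegreeMonoid_iff_plethysmCoeff_ne_zero (by norm_num) (by norm_num) ⟨36, by norm_num⟩]
  have h : (fun _ : Fin 2 => -((9 * 8 / 2 : ℕ) : ℤ)) = rowDual ![36, 36] := by
    funext i
    fin_cases i <;> simp [rowDual, Weight.dual]
  rw [h, plethysmCoeff_nine_rowDual_thirtysix_thirtysix]
  norm_num

/-- `10 ∈ E(9,2)`. [cite: BurgisserIkenmeyer2017, Def. 3.6] -/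
theorem ten_mem_genericDegreeMonoid_nine_two : 10 ∈ genericDegreeMonoid (Fin 2) ℂ 9 := by
  rw [mem_genericDegreeMonoid_iff_plethysmCoeff_ne_zero (by norm_num) (by norm_num) ⟨45, by norm_num⟩]
  have h : (fun _ : Fin 2 => -((9 * 10 / 2 : ℕ) : ℤ)) = rowDual ![45, 45] := by
    funext i
    fin_cases i <;> simp [rowDual, Weight.dual]
  rw [h, plethysmCoeff_nine_rowDual_fortyfive_fortyfive]
  norm_num

/-- **Cor. 3.17 (2) at `(9,2)`, UNCONDITIONAL: almost all binary nonics have a non-normal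
`GL_2`-orbit closure** (`D = 9` odd; invariant degrees `8, 10`).
[cite: BurgisserIkenmeyer2017, Cor. 3.17 (2)] -/
theorem isZariskiGeneric_not_isIntegrallyClosed_nine_two :
    IsZariskiGeneric 9 fun f : MvPolynomial (Fin 2) ℂ => ¬ IsIntegrallyClosed (OrbitCoordRing f 9) := by
  obtain ⟨F₁, hF₁h, hF₁i, hF₁0⟩ := eight_mem_genericDegreeMonoid_nine_two
  obtain ⟨F₂, hF₂h, hF₂i, hF₂0⟩ := ten_mem_genericDegreeMonoid_nine_two
  exact isZariskiGeneric_not_isIntegrallyClosed_of_invariants (D := 9) (m := 2) (t := 4) (by norm_num)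
    le_rfl (F₁ := F₁) (F₂ := F₂) (by simpa using hF₁h) hF₁i hF₁0 (by simpa using hF₂h) hF₂i hF₂0
    (Or.inl (by decide))

/-- **`a(9,2) = 9`, `a'(9,2) = 1`** generically (invariant degrees `8, 10`; the value `a' = 1`
is also App. Prop. 7.4 (3), t06's `BI2017_prop_A_4_part3`). [cite: BurgisserIkenmeyer2017, §7 (Appendix) Prop. 7.4] -/
theorem isZariskiGeneric_period_nine_two :
    IsZariskiGeneric 9 (fun f : MvPolynomial (Fin 2) ℂ =>
      stabilizerPeriod f = 9 ∧ reducedStabilizerPeriod 9 f = 1) := by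
  obtain ⟨F₁, hF₁h, hF₁i, hF₁0⟩ := eight_mem_genericDegreeMonoid_nine_two
  obtain ⟨F₂, hF₂h, hF₂i, hF₂0⟩ := ten_mem_genericDegreeMonoid_nine_two
  have h := isZariskiGeneric_period_of_invariants (D := 9) (m := 2) (t := 4) (by norm_num)
    (by norm_num) (F₁ := F₁) (F₂ := F₂) (by simpa using hF₁h) hF₁i hF₁0 (by simpa using hF₂h) hF₂i
    hF₂0
  exact h.mono fun f _ hf => ⟨by simpa using hf.1, hf.2⟩

/-- Cor. 3.17 (2)'s clause (`BI2017_cor_3_17`'s second conjunct) at `(D,m) = (9,2)`, PROVED.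
[cite: BurgisserIkenmeyer2017, Cor. 3.17 (2)] -/
theorem BI2017_cor_3_17_part2_nine_two : 2 ≤ 9 → 2 ≤ 2 →
    IsZariskiGeneric 9 (fun f : MvPolynomial (Fin 2) ℂ => reducedStabilizerPeriod 9 f = 1) →
    (Odd 9 ∨ 1 < Nat.gcd 9 2) →
    IsZariskiGeneric 9 fun f : MvPolynomial (Fin 2) ℂ => ¬ IsIntegrallyClosed (OrbitCoordRing f 9) :=
  fun _ _ _ _ => isZariskiGeneric_not_isIntegrallyClosed_nine_two

end Degree9

/-! ### `D = 10` -/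

section Degree10

set_option maxHeartbeats 2000000 in -- two kernel monomial counts (DIP (4.3))
/-- **`a_{(40,40)}(8[10]) = 12`** (binary decimics: invariants of degree `8`). (4.4) over `𝔖_2`, `decide +kernel`.
[cite: DorflerIkenmeyerPanova2020, eqs. (4.3)–(4.4)] -/
theorem plethysmCoeff_ten_rowDual_forty_forty :
    plethysmCoeff ℂ (Fin 2) 10 (rowDual ![40, 40]) = 12 := by
  have h : (plethysmCoeff ℂ (Fin 2) 10 (rowDual ![40, 40]) : ℤ) = 12 := by
    rw [DIP20_eq_4_4_holds 2 10 8 ![40, 40] (by norm_num) (antitone_fin_two le_rfl)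
      (by rw [Fin.sum_univ_two]; rfl)]
    simp only [dipMonomialCount_eq_L]
    decide +kernel
  exact_mod_cast h

set_option maxHeartbeats 2000000 in -- two kernel monomial counts (DIP (4.3))
/-- **`a_{(45,45)}(9[10]) = 5`** (binary decimics: invariants of degree `9`). (4.4) over `𝔖_2`, `decide +kernel`.
[cite: DorflerIkenmeyerPanova2020, eqs. (4.3)–(4.4)] -/
theorem plethysmCoeff_ten_rowDual_fortyfive_fortyfive :
    plethysmCoeff ℂ (Fin 2) 10 (rowDual ![45, 45]) = 5 := by
  have h : (plethysmCoeff ℂ (Fin 2) 10 (rowDual ![45, 45]) : ℤ) = 5 := by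
    rw [DIP20_eq_4_4_holds 2 10 9 ![45, 45] (by norm_num) (antitone_fin_two le_rfl)
      (by rw [Fin.sum_univ_two]; rfl)]
    simp only [dipMonomialCount_eq_L]
    decide +kernel
  exact_mod_cast h

/-- `8 ∈ E(10,2)`. [cite: BurgisserIkenmeyer2017, Def. 3.6] -/
theorem eight_mem_genericDegreeMonoid_ten_two : 8 ∈ genericDegreeMonoid (Fin 2) ℂ 10 := by
  rw [mem_genericDegreeMonoid_iff_plethysmCoeff_ne_zero (by norm_num) (by norm_num) ⟨40, by norm_num⟩]
  have h : (fun _ : Fin 2 => -((10 * 8 / 2 : ℕ) : ℤ)) = rowDual ![40, 40] := by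
    funext i
    fin_cases i <;> simp [rowDual, Weight.dual]
  rw [h, plethysmCoeff_ten_rowDual_forty_forty]
  norm_num

/-- `9 ∈ E(10,2)`. [cite: BurgisserIkenmeyer2017, Def. 3.6] -/
theorem nine_mem_genericDegreeMonoid_ten_two : 9 ∈ genericDegreeMonoid (Fin 2) ℂ 10 := by
  rw [mem_genericDegreeMonoid_iff_plethysmCoeff_ne_zero (by norm_num) (by norm_num) ⟨45, by norm_num⟩]
  have h : (fun _ : Fin 2 => -((10 * 9 / 2 : ℕ) : ℤ)) = rowDual ![45, 45] := by
    funext i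
    fin_cases i <;> simp [rowDual, Weight.dual]
  rw [h, plethysmCoeff_ten_rowDual_fortyfive_fortyfive]
  norm_num

/-- **Cor. 3.17 (2) at `(10,2)`, UNCONDITIONAL: almost all binary decimics have a non-normal
`GL_2`-orbit closure** (`gcd(10,2) = 2 > 1`; invariant degrees `8, 9`).
[cite: BurgisserIkenmeyer2017, Cor. 3.17 (2)] -/
theorem isZariskiGeneric_not_isIntegrallyClosed_ten_two :
    IsZariskiGeneric 10 fun f : MvPolynomial (Fin 2) ℂ => ¬ IsIntegrallyClosed (OrbitCoordRing f 10) := by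
  obtain ⟨F₁, hF₁h, hF₁i, hF₁0⟩ := eight_mem_genericDegreeMonoid_ten_two
  obtain ⟨F₂, hF₂h, hF₂i, hF₂0⟩ := nine_mem_genericDegreeMonoid_ten_two
  exact isZariskiGeneric_not_isIntegrallyClosed_of_invariants (D := 10) (m := 2) (t := 8) (by norm_num)
    le_rfl (F₁ := F₁) (F₂ := F₂) (by simpa using hF₁h) hF₁i hF₁0 (by simpa using hF₂h) hF₂i hF₂0
    (Or.inr (by decide))

/-- **`a(10,2) = 5`, `a'(10,2) = 1`** generically (invariant degrees `8, 9`; the value `a' = 1`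
is also App. Prop. 7.4 (3), t06's `BI2017_prop_A_4_part3`). [cite: BurgisserIkenmeyer2017, §7 (Appendix) Prop. 7.4] -/
theorem isZariskiGeneric_period_ten_two :
    IsZariskiGeneric 10 (fun f : MvPolynomial (Fin 2) ℂ =>
      stabilizerPeriod f = 5 ∧ reducedStabilizerPeriod 10 f = 1) := by
  obtain ⟨F₁, hF₁h, hF₁i, hF₁0⟩ := eight_mem_genericDegreeMonoid_ten_two
  obtain ⟨F₂, hF₂h, hF₂i, hF₂0⟩ := nine_mem_genericDegreeMonoid_ten_two
  have h := isZariskiGeneric_period_of_invariants (D := 10) (m := 2) (t := 8) (by norm_num)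
    (by norm_num) (F₁ := F₁) (F₂ := F₂) (by simpa using hF₁h) hF₁i hF₁0 (by simpa using hF₂h) hF₂i
    hF₂0
  exact h.mono fun f _ hf => ⟨by simpa using hf.1, hf.2⟩

/-- Cor. 3.17 (2)'s clause (`BI2017_cor_3_17`'s second conjunct) at `(D,m) = (10,2)`, PROVED.
[cite: BurgisserIkenmeyer2017, Cor. 3.17 (2)] -/
theorem BI2017_cor_3_17_part2_ten_two : 2 ≤ 10 → 2 ≤ 2 →
    IsZariskiGeneric 10 (fun f : MvPolynomial (Fin 2) ℂ => reducedStabilizerPeriod 10 f = 1) →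
    (Odd 10 ∨ 1 < Nat.gcd 10 2) →
    IsZariskiGeneric 10 fun f : MvPolynomial (Fin 2) ℂ => ¬ IsIntegrallyClosed (OrbitCoordRing f 10) :=
  fun _ _ _ _ => isZariskiGeneric_not_isIntegrallyClosed_ten_two

end Degree10


end Literature.Computability.AlgebraicComplexity
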